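import Literature.AnabelianGeometry.SemiGraphs.TemperedCurves
import HarnessLib

/-!
# Example 3.10 interface, additive: the augmentation `Π^tp → G_K` is an OPEN map

Mochizuki, *Semi-graphs of anabelioids*, Publ. RIMS **42** (2006), Example 3.10 p. 43 and §6 p. 69
[cite: MochizukiSemiAnbd2006, Ex 3.10 p.43 and §6 p.69]: `π₁^temp(X_K)` "is a tempered topological
group … and fits into a natural exact sequence `1 → π₁^temp(X_K̄) → π₁^temp(X_K) → G_K → 1`" — an exact
sequence of TOPOLOGICAL groups, so that `G_K` carries the quotient topology of `Π^tp := π₁^temp(X_K)`,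
i.e. the augmentation is an open map ([EtTh] PRIMS p. 237 = PDF p. 11 quotes the same sequence).
The interface `TemperedArithmeticGroup` (`TemperedCurves.lean`, FROZEN) records the augmentation as
a continuous surjection `aug : Π^tp →ₜ* G_K`; that it is OPEN is NOT derivable from the typed axioms
(continuity, surjectivity and the completion data do not exclude a finer group topology on `Π^tp`
with the same algebraic data) — finder abc-iut-L2-d1, ruling ο2 (abc-iut-L3-lead, 2026-08-25):
recorded here as an ADDITIVE named hypothesis `AugIsOpenMap`, carried by consumers that need the
continuity of classes inflated from `G_K` to descend (Kummer theory on `G_K`, [EtTh] Def. 2.13 (i)).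
Nothing is asserted; no field of the frozen structure is changed.
-/

open Topology

namespace Literature.AnabelianGeometry.SemiGraphs

namespace TemperedArithmeticGroup

universe u

variable {K : Type u} [Field K] (T : TemperedArithmeticGroup K)

/-- **The augmentation `Π^tp → G_K` is open** ([SemiAnbd] Ex. 3.10 p. 43 / §6 p. 69: `π₁^temp(X_K)`
"fits into a natural exact sequence `1 → π₁^temp(X_K̄) → π₁^temp(X_K) → G_K → 1`" of topological
groups — `G_K` is the topological quotient; [EtTh] p. 237), named hypothesis: `T.aug` is an open
map.  Not derivable from the fields of `TemperedArithmeticGroup` (finer group topologies with the same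
algebraic data exist); carried as a hypothesis `(h : T.AugIsOpenMap)` by consumers (ruling ο2).
[cite: MochizukiSemiAnbd2006, Ex 3.10 p.43] -/
def AugIsOpenMap : Prop := IsOpenMap T.aug

/-- Unfolding of `AugIsOpenMap`. [cite: MochizukiSemiAnbd2006, Ex 3.10 p.43] -/
theorem augIsOpenMap_iff : T.AugIsOpenMap ↔ IsOpenMap T.aug := Iff.rfl

/-- Under `AugIsOpenMap`, the augmentation is an open quotient map (surjective, continuous, open):
`G_K` carries the quotient topology of `Π^tp`. [cite: MochizukiSemiAnbd2006, Ex 3.10 p.43] -/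
theorem isOpenQuotientMap_aug_of (h : T.AugIsOpenMap) : IsOpenQuotientMap T.aug :=
  ⟨T.aug_surjective, T.aug.continuous, h⟩

/-- In particular the augmentation is a quotient map. [cite: MochizukiSemiAnbd2006, Ex 3.10 p.43] -/
theorem isQuotientMap_aug_of (h : T.AugIsOpenMap) : IsQuotientMap T.aug :=
  (T.isOpenQuotientMap_aug_of h).isQuotientMap

end TemperedArithmeticGroup

end Literature.AnabelianGeometry.SemiGraphs
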